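import Summits.QuantumFields.BalabanUV.Beta.EriceRemainderEnclosureHistoryAutonomyComparisonDualDiminishingShares

/-!
# EriceRemainderEnclosureHistoryAutonomyComparisonDualDiminishingRow — (E137b) **THE DUAL ROW INEQUALITY FOR NON-SEPARABLE MEMORY WITH DIMINISHING RETURNS.**
# Setting of (E137a) `…ComparisonDualDiminishingShares`: a memory `B` of finite range `K` on the closed box, ISOTONE, with DIMINISHING RETURNS (coordinate increments over a
# fixed interval antitone in the configuration) and COORDINATEWISE CONCAVE, `B(0) ≥ 0`; floor `b > 0`, modulus, unique box solutions `S p` on ]0,γ]; `B′` with floor and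
# ISOTONE excess; `h′` a box solution of `B′`.  At a row `n` with comparison from the pin `h′_{n+1}` and non-negative dual steps above, **`dr_row_ge`**:
# `X′_{n+1} − max(X′_n,0)·Σ_k λ_k (S h′_n)_{1+k}²x_k∕2 − Σ_k λ_k x_k³Φ⁰_k·w_k²δ_k ≤ X′_n` with the STAIRCASE chord slopes `λ_k = [B(P^{k+1}) − B(P^k)]∕(x_k − x_{k+1})` of the
# configuration `x = S h′_{n+1}` (`P^k = (x_0..x_{k−1}, x_{k+1}, …)`) — (E133) `dual_row_ge` ∕ (E136a) `concave_row_ge` for the non-separable class.  PROOF: the drop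
# difference `drop_n − drop_{n+1}` is TWO-PIN + BASE ADVANCE − PERTURBED ADVANCE, `[B(σ_{1+·}) − B(x)] + [B(x) − B(x_{1+·})] − [B(w) − B(w_{1+·})]`, and each bracket
# telescopes along its own staircase (`R^k` from `x` up to `σ_{1+·} = tail_1 S h′_n`, `P^k`, `Q^k` from `w_{1+·}` to `w = tail_{n+1}h′`); coordinate by coordinate: the base
# advance IS `λ_k Δ⁰_k`; the perturbed advance is `≥ λ_k Δ′_k` (diminishing returns from `P^k` down to `Q^k ≤ P^k`, then the chord below-left, (E136a) `chord_pert_ge`); the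
# two-pin offset is `≤ λ_k T1_k` when the pins are ordered (diminishing returns from `R^k ≥ P^k` down to `P^k`, then the chord above-right, `chord_twopin_le`; `T1_k ≤ X′_n σ²x∕2` by
# (E133) `dual_two_pin_le`) and `≤ 0` otherwise (`dual_two_pin_nonpos`, isotonicity); the deficit `Δ⁰_k − Δ′_k` by (E137a) `dr_deficit_le`.

Cell `pub-balaban`, β-function sub-cell, BINDER row D4 «RemainderConst leaves for Bałaban's split» (`HOME/BINDER-OWNERS.md`; owner lineage `b2b-balaban-beta-an4`;
this file by co-owner #2 lineage `b2b-balaban-beta-d4-p2`, generation 105), β-FLOW TEAM duty (1), FREEZE (0) honoured (def-free; imports (E137a); uses (E137a) `stair_succ` ∕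
`stair_eq_update` ∕ `stair_zero` ∕ `cbox_stair` ∕ `cbox_of_seqBox` ∕ `cbox_update` ∕ `dr_deficit_le`, (E136a) `chord_pert_ge` ∕ `chord_twopin_le`, (E133) `dual_two_pin_le` ∕
`dual_two_pin_nonpos`, (E132) `dual_source_antitone`, (E48a) `family_zero` ∕ `strictAnti_of_memFlow` BY NAME; nothing restated).

HONEST FRAMING (page 1, verbatim and binding).  *"Discharging BetaPertH makes Bałaban's UV stability UNCONDITIONAL — a real constructive-QFT result; it is
NOT the continuum limit and NOT the Clay problem."*  THIS FILE DISCHARGES NOTHING OF THE KIND.  Elementary real analysis about ABSTRACT functionals on a box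
]0,γ]^ℕ — hypotheses of a census, not facts; the form, signs, ages, moments and convexity of Bałaban's (1.22) limit functional are NOT PRINTED ([I] p. 298; GAPS
G-t4-U2-1∕-2) and NOT asserted.  Row D4 class UNCHANGED (critical-path width 0; instance 0∕1; D4 DISCHARGE NO DATE).  NOT CLAIMED here: the comparison theorem (the
sequels (E137c∕d)); anything printed — NOT B12 Thm 2, NOT BetaPertH, NOT continuum, NOT Clay.

WHAT IS PROVED ([folklore]; 0 `def`, 0 sorry).  **`dr_row_ge`**.
-/

noncomputable section
open Finset Set

namespace Summit.QuantumFields.BalabanUV.Beta.EriceRemainderEnclosureHistoryAutonomyComparisonDualDiminishingRow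

open Literature.MathematicalPhysics.QuantumFieldTheory.Balaban1983to89
open Literature.MathematicalPhysics.QuantumFieldTheory.Balaban1983to89.T4BetaStationary
open Literature.MathematicalPhysics.QuantumFieldTheory.Balaban1983to89.T4BetaFlowWellPosed
open Summit.QuantumFields.BalabanUV.Beta.EriceRemainderEnclosureHistoryAutonomyOrder
  (family_zero family_mem family_tail_eq family_succ_eq le_of_pin_le strictAnti_of_memFlow)
open Summit.QuantumFields.BalabanUV.Beta.EriceRemainderEnclosureHistoryAutonomyComparisonDualOrbit (dual_source_antitone)
open Summit.QuantumFields.BalabanUV.Beta.EriceRemainderEnclosureHistoryAutonomyComparisonDualRow (dual_two_pin_le dual_two_pin_nonpos)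
open Summit.QuantumFields.BalabanUV.Beta.EriceRemainderEnclosureHistoryAutonomyComparisonDualConcaveRow (chord_pert_ge chord_twopin_le)
open Summit.QuantumFields.BalabanUV.Beta.EriceRemainderEnclosureHistoryAutonomyComparisonDualDiminishingShares
  (stair_succ stair_eq_update stair_zero cbox_stair cbox_of_seqBox cbox_update stair_budget dr_deficit_le)

variable {B B' : (ℕ → ℝ) → ℝ} {M γ b : ℝ} {K : ℕ} {S : ℝ → ℕ → ℝ} {h' : ℕ → ℝ}

/-! ## §1 The dual row inequality for diminishing-returns memory -/

set_option maxHeartbeats 800000 in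
/-- **THE DUAL ROW INEQUALITY FOR NON-SEPARABLE MEMORY WITH DIMINISHING RETURNS.**  `B` of range `K` on the closed box: isotone, diminishing returns, coordinatewise concave,
`B(0) ≥ 0`; floor `b > 0`, modulus, unique box solutions `S p`; `B′` with floor and ISOTONE excess, `h′` a box solution of `B′`.  At a row `n` with comparison from the pin
`h′_{n+1}` and non-negative dual steps above, with the staircase chord slopes `λ_k = [B(P^{k+1}) − B(P^k)]∕(x_k − x_{k+1})` of `x = S h′_{n+1}`:
`X′_{n+1} − max(X′_n,0)·Σ_k λ_k (S h′_n)_{1+k}²x_k∕2 − Σ_k λ_k x_k³Φ⁰_k·w_k²δ_k ≤ X′_n` — (E133) `dual_row_ge` with `λ_k` for `L_k`: base advance `= λ_k·Δ⁰_k` exactly (telescoping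
along `P^k`), perturbed advance `≥ λ_k·Δ′_k` and two-pin offset `≤ λ_k·T1_k` by diminishing returns between the staircases and concavity along one coordinate. [folklore] -/
theorem dr_row_ge (hK : ∀ u v : ℕ → ℝ, (∀ j, j < K → u j = v j) → B u = B v)
    (hmonoC : ∀ u v : ℕ → ℝ, (∀ j, 0 ≤ u j ∧ u j ≤ γ) → (∀ j, 0 ≤ v j ∧ v j ≤ γ) → (∀ j, u j ≤ v j) → B u ≤ B v)
    (hDR : ∀ u v : ℕ → ℝ, (∀ j, 0 ≤ u j ∧ u j ≤ γ) → (∀ j, 0 ≤ v j ∧ v j ≤ γ) → (∀ j, u j ≤ v j) → ∀ (k : ℕ) (a c : ℝ), 0 ≤ a → a ≤ c → c ≤ γ →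
      B (Function.update v k c) - B (Function.update v k a) ≤ B (Function.update u k c) - B (Function.update u k a))
    (hconc : ∀ u : ℕ → ℝ, (∀ j, 0 ≤ u j ∧ u j ≤ γ) → ∀ (k : ℕ) (a c d e : ℝ), 0 ≤ a → a < c → 0 ≤ d → d < e → a ≤ d → c ≤ e → e ≤ γ →
      (B (Function.update u k e) - B (Function.update u k d)) * (c - a) ≤ (B (Function.update u k c) - B (Function.update u k a)) * (e - d))
    (hB0 : 0 ≤ B (fun _ => 0))
    (hb : 0 < b)
    (hmono : ∀ u v : ℕ → ℝ, SeqBox γ u → SeqBox γ v → (∀ i, u i ≤ v i) → B u ≤ B v)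
    (hB : ∀ u u' : ℕ → ℝ, SeqBox γ u → SeqBox γ u' → ∀ D : ℝ, (∀ j, |u j - u' j| ≤ D) → |B u - B u'| ≤ M * D) (hM : 0 ≤ M)
    (hlo : ∀ u, SeqBox γ u → b ≤ B u)
    (hS : ∀ p, 0 < p → p ≤ γ → SeqBox γ (S p) ∧ MemFlow B p (S p))
    (huniq : ∀ p, 0 < p → p ≤ γ → ∀ u u' : ℕ → ℝ, SeqBox γ u → SeqBox γ u' → MemFlow B p u → MemFlow B p u' → u = u')
    (hlo' : ∀ u, SeqBox γ u → b ≤ B' u)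
    (hDmono : ∀ u v : ℕ → ℝ, SeqBox γ u → SeqBox γ v → (∀ i, u i ≤ v i) → B' u - B u ≤ B' v - B v)
    (hh' : SeqBox γ h') {y : ℝ} (hf' : MemFlow B' y h') (n : ℕ)
    (hcmp : ∀ l, h' (n + 1 + l) ≤ S (h' (n + 1)) l)
    (hXup : ∀ l, 0 ≤ B' (fun i => h' (n + 1 + l + 1 + i)) - B (fun i => S (h' (n + 1 + l)) (1 + i))) :
    (B' (fun i => h' (n + 1 + 1 + i)) - B (fun i => S (h' (n + 1)) (1 + i)))
      - max (B' (fun i => h' (n + 1 + i)) - B (fun i => S (h' n) (1 + i))) 0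
          * ∑ k ∈ range K, (B (fun j => if j < k + 1 then S (h' (n + 1)) j else S (h' (n + 1)) (j + 1))
                - B (fun j => if j < k then S (h' (n + 1)) j else S (h' (n + 1)) (j + 1))) / (S (h' (n + 1)) k - S (h' (n + 1)) (k + 1))
              * (S (h' n) (1 + k) ^ 2 * S (h' (n + 1)) k / 2)
      - ∑ k ∈ range K, (B (fun j => if j < k + 1 then S (h' (n + 1)) j else S (h' (n + 1)) (j + 1))
                - B (fun j => if j < k then S (h' (n + 1)) j else S (h' (n + 1)) (j + 1))) / (S (h' (n + 1)) k - S (h' (n + 1)) (k + 1))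
          * (S (h' (n + 1)) k ^ 3 * (1 / S (h' (n + 1)) (k + 1) ^ 2 - 1 / S (h' (n + 1)) k ^ 2)
            * (h' (n + 1 + k) ^ 2 * (1 / h' (n + 1 + k) ^ 2 - 1 / S (h' (n + 1)) k ^ 2)))
      ≤ B' (fun i => h' (n + 1 + i)) - B (fun i => S (h' n) (1 + i)) := by
  have hpos : ∀ j, 0 < h' j := fun j => (hh' j).1
  have hanti' := strictAnti_of_memFlow hb hlo' hh' hf'
  have hanti : Antitone h' := hanti'.antitone
  have hγ : 0 ≤ γ := (hh' 0).1.le.trans (hh' 0).2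
  have hpn := hh' n
  have hp1 := hh' (n + 1)
  have hSn := hS (h' n) hpn.1 hpn.2
  have hS1 := hS (h' (n + 1)) hp1.1 hp1.2
  have hxanti := strictAnti_of_memFlow hb hlo hS1.1 hS1.2
  -- the four sequences: x (base from h′_{n+1}), xs (its shift), w (the perturbed tail), ws (its shift), σ1 (base from h′_n, shifted)
  set x : ℕ → ℝ := S (h' (n + 1)) with hxdef
  set xs : ℕ → ℝ := fun j => S (h' (n + 1)) (j + 1) with hxsdef
  set w : ℕ → ℝ := fun j => h' (n + 1 + j) with hwdef
  set ws : ℕ → ℝ := fun j => h' (n + 1 + (j + 1)) with hwsdef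
  set σ1 : ℕ → ℝ := fun j => S (h' n) (1 + j) with hσ1def
  have hxpos : ∀ k, 0 < x k := fun k => (hS1.1 k).1
  have hxC : ∀ j, 0 ≤ x j ∧ x j ≤ γ := cbox_of_seqBox hS1.1
  have hxsC : ∀ j, 0 ≤ xs j ∧ xs j ≤ γ := fun j => hxC (j + 1)
  have hwB : SeqBox γ w := fun j => hh' (n + 1 + j)
  have hwC : ∀ j, 0 ≤ w j ∧ w j ≤ γ := cbox_of_seqBox hwB
  have hwsC : ∀ j, 0 ≤ ws j ∧ ws j ≤ γ := fun j => hwC (j + 1)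
  have hσB : SeqBox γ σ1 := fun j => hSn.1 (1 + j)
  have hσC : ∀ j, 0 ≤ σ1 j ∧ σ1 j ≤ γ := cbox_of_seqBox hσB
  -- staircases
  set P : ℕ → ℕ → ℝ := fun k j => if j < k then x j else xs j with hPdef
  set Q : ℕ → ℕ → ℝ := fun k j => if j < k then w j else ws j with hQdef
  set R : ℕ → ℕ → ℝ := fun k j => if j < k then σ1 j else x j with hRdef
  have hPC : ∀ k, ∀ j, 0 ≤ P k j ∧ P k j ≤ γ := fun k => cbox_stair hxC hxsC k
  have hQC : ∀ k, ∀ j, 0 ≤ Q k j ∧ Q k j ≤ γ := fun k => cbox_stair hwC hwsC k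
  have hRC : ∀ k, ∀ j, 0 ≤ R k j ∧ R k j ≤ γ := fun k => cbox_stair hσC hxC k
  have hPs : ∀ k, P (k + 1) = Function.update (P k) k (x k) := fun k => stair_succ x xs k
  have hPe : ∀ k, P k = Function.update (P k) k (x (k + 1)) := fun k => stair_eq_update x xs k
  have hQs : ∀ k, Q (k + 1) = Function.update (Q k) k (w k) := fun k => stair_succ w ws k
  have hQe : ∀ k, Q k = Function.update (Q k) k (w (k + 1)) := fun k => by
    have := stair_eq_update w ws k; simp only [hwsdef, hwdef] at this ⊢; rw [show n + 1 + (k + 1) = n + 1 + k + 1 by ring]; exact this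
  have hRs : ∀ k, R (k + 1) = Function.update (R k) k (σ1 k) := fun k => stair_succ σ1 x k
  have hRe : ∀ k, R k = Function.update (R k) k (x k) := fun k => stair_eq_update σ1 x k
  have hQP : ∀ k, ∀ j, Q k j ≤ P k j := by
    intro k j
    show (if j < k then w j else ws j) ≤ (if j < k then x j else xs j)
    by_cases hj : j < k
    · simp only [hj, ↓reduceIte]; exact hcmp j
    · simp only [hj, ↓reduceIte]; exact hcmp (j + 1)
  -- the source only grows going down
  have hsrc := dual_source_antitone (B := B) (B' := B') hDmono hh' hanti n
  rw [show n + 2 = n + 1 + 1 by ring] at hsrc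
  -- the level form of X′_n
  have hXlev : B' (fun i => h' (n + 1 + i)) - B (fun i => S (h' n) (1 + i)) = 1 / h' (n + 1) ^ 2 - 1 / S (h' n) 1 ^ 2 := by
    have e1 : 1 / h' (n + 1) ^ 2 = 1 / h' n ^ 2 + B' (fun i => h' (n + 1 + i)) := hf'.2 n
    have e2 : 1 / S (h' n) (0 + 1) ^ 2 = 1 / S (h' n) 0 ^ 2 + B (fun i => S (h' n) (0 + 1 + i)) := hSn.2.2 0
    rw [family_zero hS hpn.1 hpn.2] at e2
    simp only [Nat.zero_add] at e2
    have e3 : (fun i => S (h' n) (0 + 1 + i)) = (fun i => S (h' n) (1 + i)) := by funext i; simp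
    rw [e3] at e2
    linarith
  set X0 : ℝ := B' (fun i => h' (n + 1 + i)) - B (fun i => S (h' n) (1 + i)) with hX0
  -- identification of the functional values at the ends of the staircases
  have eP0 : B (P 0) = B (fun i => S (h' (n + 1)) (1 + i)) := by
    rw [show P 0 = xs from stair_zero x xs]; congr 1; funext i; simp [hxsdef, Nat.add_comm]
  have ePK : B (P K) = B x := hK _ _ fun j hj => by simp [hPdef, hj]
  have eQ0 : B' (Q 0) - (B' (Q 0) - B (Q 0)) = B (fun i => h' (n + 1 + 1 + i)) := by
    rw [show Q 0 = ws from stair_zero w ws]; ring_nf; congr 1; funext i; simp only [hwsdef]; ring_nf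
  have eQK : B (Q K) = B w := hK _ _ fun j hj => by simp [hQdef, hj]
  have eR0 : B (R 0) = B x := by rw [show R 0 = x from stair_zero σ1 x]
  have eRK : B (R K) = B σ1 := hK _ _ fun j hj => by simp [hRdef, hj]
  have ew : (fun i => h' (n + 1 + i)) = w := rfl
  have ews : (fun i => h' (n + 1 + 1 + i)) = ws := by funext i; simp only [hwsdef]; ring_nf
  -- per coordinate
  have hage : ∀ k ∈ range K,
      (B (R (k + 1)) - B (R k)) + (B (P (k + 1)) - B (P k)) - (B (Q (k + 1)) - B (Q k))
        ≤ max X0 0 * ((B (P (k + 1)) - B (P k)) / (x k - x (k + 1)) * (S (h' n) (1 + k) ^ 2 * x k / 2))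
          + (B (P (k + 1)) - B (P k)) / (x k - x (k + 1))
            * (x k ^ 3 * (1 / x (k + 1) ^ 2 - 1 / x k ^ 2) * (h' (n + 1 + k) ^ 2 * (1 / h' (n + 1 + k) ^ 2 - 1 / x k ^ 2))) := by
    intro k _
    have hxk := hxpos k
    have hxk1 := hxpos (k + 1)
    have hlt : x (k + 1) < x k := hxanti (Nat.lt_succ_self k)
    have hxkγ : x k ≤ γ := (hS1.1 k).2
    have hd : 0 < x k - x (k + 1) := by linarith
    have hwk : 0 < w k := hpos _
    have hwk1 : 0 < w (k + 1) := hpos _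
    have hwlt : w (k + 1) < w k := hanti' (show n + 1 + k < n + 1 + (k + 1) by omega)
    have hwx : w k ≤ x k := hcmp k
    have hwx1 : w (k + 1) ≤ x (k + 1) := hcmp (k + 1)
    have hσ : 0 < σ1 k := (hSn.1 (1 + k)).1
    have hσγ : σ1 k ≤ γ := (hSn.1 (1 + k)).2
    set lam : ℝ := (B (P (k + 1)) - B (P k)) / (x k - x (k + 1)) with hlam
    -- the slope through the coordinate function g(t) = B(P k | t)
    have hg1 : B (Function.update (P k) k (x k)) = B (P (k + 1)) := by rw [← hPs k]
    have hg0 : B (Function.update (P k) k (x (k + 1))) = B (P k) := by rw [← hPe k]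
    have hlam0 : 0 ≤ lam := by
      have hnum : 0 ≤ B (P (k + 1)) - B (P k) := by
        rw [← hg1, ← hg0]
        refine sub_nonneg.mpr (hmonoC _ _ (cbox_update (hPC k) hxk1.le (hxC (k + 1)).2 k) (cbox_update (hPC k) hxk.le hxkγ k) fun j => ?_)
        rcases eq_or_ne j k with rfl | hjk
        · simp [hlt.le]
        · rw [Function.update_of_ne hjk, Function.update_of_ne hjk]
      exact div_nonneg hnum hd.le
    -- the concavity of g in the (0 < a)-form used by the chord lemmas of (E136a)
    have hgconc : ∀ a c d e : ℝ, 0 < a → a < c → 0 < d → d < e → a ≤ d → c ≤ e → e ≤ γ →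
        (B (Function.update (P k) k e) - B (Function.update (P k) k d)) * (c - a)
          ≤ (B (Function.update (P k) k c) - B (Function.update (P k) k a)) * (e - d) :=
      fun a c d e ha hac hd0 hde had hce he => hconc (P k) (hPC k) k a c d e ha.le hac hd0.le hde had hce he
    -- (i) the perturbed advance is at least λ·Δ′: DR down from P k to Q k, then the chord below-left
    have h1 : lam * (w k - w (k + 1)) ≤ B (Q (k + 1)) - B (Q k) := by
      have hc := chord_pert_ge (g := fun t => B (Function.update (P k) k t)) hgconc hwk1 hwlt hlt hwx hwx1 hxkγ
      simp only [hg1, hg0] at hc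
      have hdr := hDR (Q k) (P k) (hQC k) (hPC k) (hQP k) k (w (k + 1)) (w k) hwk1.le hwlt.le ((hwx).trans hxkγ)
      rw [← hQs k, ← hQe k] at hdr
      linarith [hc, hdr]
    -- (ii) the base advance is λ·Δ⁰ exactly
    have h2 : B (P (k + 1)) - B (P k) = lam * (x k - x (k + 1)) := by
      rw [hlam, div_mul_cancel₀]; exact ne_of_gt hd
    -- (iii) the two-pin offset
    have h3 : B (R (k + 1)) - B (R k) ≤ max X0 0 * (lam * (S (h' n) (1 + k) ^ 2 * x k / 2)) := by
      have hpos3 : 0 ≤ lam * (S (h' n) (1 + k) ^ 2 * x k / 2) := by positivity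
      rcases le_total (h' (n + 1)) (S (h' n) 1) with hle | hle
      · -- ordered pins: R k ≥ P k, DR, then the chord above-right
        have hord : ∀ j, x j ≤ σ1 j := fun j => by
          have := (dual_two_pin_le hb hmono hB hM hlo hS huniq hh' n hle j).1
          simp only [hσ1def, hxdef]; linarith
        obtain ⟨_, hT⟩ := dual_two_pin_le hb hmono hB hM hlo hS huniq hh' n hle k
        rw [← hXlev] at hT
        have hRP : ∀ j, P k j ≤ R k j := fun j => by
          show (if j < k then x j else xs j) ≤ (if j < k then σ1 j else x j)
          by_cases hj : j < k
          · simp only [hj, ↓reduceIte]; exact hord j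
          · simp only [hj, ↓reduceIte]; exact hxanti.antitone (Nat.le_succ j)
        have hdr := hDR (P k) (R k) (hPC k) (hRC k) hRP k (x k) (σ1 k) hxk.le (hord k) hσγ
        rw [← hRs k, ← hRe k, hg1] at hdr
        have hc := chord_twopin_le (g := fun t => B (Function.update (P k) k t)) hgconc hxk1 hlt (hord k) hσγ
        simp only [hg1, hg0] at hc
        have h4 : lam * (σ1 k - x k) ≤ lam * (X0 * (S (h' n) (1 + k) ^ 2 * x k / 2)) := mul_le_mul_of_nonneg_left hT hlam0
        have h5 : X0 ≤ max X0 0 := le_max_left _ _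
        have h6 : 0 ≤ S (h' n) (1 + k) ^ 2 * x k / 2 := by positivity
        nlinarith [mul_le_mul_of_nonneg_right h5 (mul_nonneg hlam0 h6), hdr, hc, h4]
      · -- reversed pins: the offset is non-positive
        have hT := dual_two_pin_nonpos hb hB hM hlo hS huniq hh' n hle k
        have hle' : σ1 k ≤ x k := by simp only [hσ1def, hxdef]; linarith
        have hRle : B (R (k + 1)) ≤ B (R k) := by
          rw [hRs k]; conv_rhs => rw [hRe k]
          refine hmonoC _ _ (cbox_update (hRC k) hσ.le hσγ k) (cbox_update (hRC k) hxk.le hxkγ k) fun j => ?_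
          rcases eq_or_ne j k with rfl | hjk
          · simp [hle']
          · rw [Function.update_of_ne hjk, Function.update_of_ne hjk]
        nlinarith [mul_nonneg (le_max_right X0 0) hpos3]
    -- (iv) the deficit
    have hdef := dr_deficit_le (B' := B') hK hmonoC hDR hconc hB0 hb hmono hB hM hlo hS huniq hh' hf' (n + 1) k hwx
      (by have := hXup k; linarith)
    have h4 := mul_le_mul_of_nonneg_left hdef hlam0
    rw [show n + 1 + k + 1 = n + 1 + (k + 1) by ring, mul_sub] at h4
    have ewk : h' (n + 1 + k) = w k := rfl
    have ewk1 : h' (n + 1 + (k + 1)) = w (k + 1) := rfl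
    rw [ewk, ewk1] at h4
    rw [ewk]
    linarith [h1, h2, h3, h4]
  have hsum := sum_le_sum hage
  rw [sum_sub_distrib, sum_add_distrib, sum_range_sub (fun k => B (R k)), sum_range_sub (fun k => B (P k)), sum_range_sub (fun k => B (Q k)),
    sum_add_distrib, ← mul_sum, ePK, eP0, eR0, eRK, eQK] at hsum
  -- X′_n = E_n − [B σ1 − B w],  X′_{n+1} = E_{n+1} − [B(P 0) − B(Q 0)]
  have hQ0box : SeqBox γ (Q 0) := by rw [show Q 0 = ws from stair_zero w ws]; exact fun j => hh' _
  have eE1 : B' (fun i => h' (n + 1 + 1 + i)) - B (fun i => h' (n + 1 + 1 + i)) = B' (Q 0) - B (Q 0) := by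
    rw [ews, show Q 0 = ws from stair_zero w ws]
  rw [ews] at hsrc ⊢
  rw [show ws = Q 0 from (stair_zero w ws).symm] at hsrc ⊢
  simp only [hxdef] at hsum ⊢
  nlinarith [hsum, hsrc, le_refl (B σ1), le_refl (B w)]

end Summit.QuantumFields.BalabanUV.Beta.EriceRemainderEnclosureHistoryAutonomyComparisonDualDiminishingRow

end
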